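import Summits.Ventures.Crystal3D.Bulk.GapRhombusBounds
import Summits.Ventures.Crystal3D.Bulk.GapCornerEnvelopes
import HarnessLib

/-!
# The three R5 rhombus rows of `alp.py` EXACTLY AS CODED (degrees, outward literals
# `TAU_HI = 70.5287794`, `TAU_LO = 70.5287793`)

HONEST FRAMING. Part of the venture `Summits/Ventures/Crystal3D` (cell `pub-crystal3d`, phase 2;
seat p2, PROMOTION-AUDIT prep). A two-line corollary of `Bulk/GapRhombusBounds.lean` (the rows in
closed form: `u ≤ 2τ`, `3τ ≤ u + v ≤ 2π − 2τ`, `τ = arccos (1/3)`) and `Bulk/GapCornerEnvelopes.lean`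
(the 13-digit kernel bracket `1.2309594173407 < τ < 1.2309594173408` and Mathlib's 20-digit `π`):
the rows with alp's rational literals, i.e. exactly the constraints
`extra_rows.append(('ub', {u_k: 1}, 2 * TAU_HI))`, `('ub', {u₀: 1, u₁: 1}, 360 - 2 * TAU_LO)`,
`('ub', {u₀: -1, u₁: -1}, -3 * TAU_LO)` of `alp.py` l.373–379 (dossier
`phase2/ENV-CENSUS/impla/audit-prep-g8/A-FAMILY-AUDIT-DOSSIER-engine4-g8.md` §2.2 R5, §3 B5).
Kept in its own file so that the bracket file imports only long-built modules. Nothing here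
asserts anything about GAP(1.26); no census number moves.
-/

noncomputable section

open scoped BigOperators InnerProductSpace
open Finset Real

namespace Summit.Ventures.Crystal3D

section ConfigRhombusDeg

open Literature.Geometry.DiscreteGeometry InnerProductGeometry

variable {c : Fin 14 → EuclideanSpace ℝ (Fin 3)}

/-- **The three R5 rows exactly as coded in `alp.py` (degrees, outward literals
`TAU_HI = 70.5287794`, `TAU_LO = 70.5287793`)**: for the tight shell rhombus `a b e d` of an
admissible configuration with `intruderDist c < 2`, writing `u° = corner · 180/π`:
`u_a° ≤ 2·TAU_HI`, `3·TAU_LO ≤ u_a° + u_b°`, `u_a° + u_b° ≤ 360 − 2·TAU_LO`.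
[cite: FlatleyEtAl2013, Lemma 6 (5),(7)] -/
theorem IsGapConfig.rhombus_rows_deg (hc : IsGapConfig c) (hD : intruderDist c < 2)
    {a b e d : Fin 14} (ha0 : a ≠ 0) (ha13 : a ≠ 13) (hb0 : b ≠ 0) (hb13 : b ≠ 13)
    (he0 : e ≠ 0) (he13 : e ≠ 13) (hd0 : d ≠ 0) (hd13 : d ≠ 13) (hae : a ≠ e) (hbd : b ≠ d)
    (hab : dist (c a) (c b) = 1) (hbe : dist (c b) (c e) = 1) (hed : dist (c e) (c d) = 1)
    (hda : dist (c d) (c a) = 1) :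
    corner c a b d * (180 / π) ≤ 2 * 70.5287794 ∧
      3 * 70.5287793 ≤ (corner c a b d + corner c b a e) * (180 / π) ∧
      (corner c a b d + corner c b a e) * (180 / π) ≤ 360 - 2 * 70.5287793 := by
  have h1 := hc.rhombus_corner_le hD ha0 ha13 hb0 hb13 he0 he13 hd0 hd13 hae hbd hab hbe hed hda
  obtain ⟨h2, h3⟩ :=
    hc.rhombus_corner_add_bounds hD ha0 ha13 hb0 hb13 he0 he13 hd0 hd13 hae hbd hab hbe hed hda
  have hτ1 := arccos_third_gt_d13
  have hτ2 := arccos_third_lt_d13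
  have hπ1 := pi_gt_d20
  have hπ2 := pi_lt_d20
  refine ⟨?_, ?_, ?_⟩
  · rw [mul_div_assoc', div_le_iff₀ pi_pos]; nlinarith
  · rw [mul_div_assoc', le_div_iff₀ pi_pos]; nlinarith
  · rw [mul_div_assoc', div_le_iff₀ pi_pos]; nlinarith

end ConfigRhombusDeg

end Summit.Ventures.Crystal3D
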